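import Summits.BirchSwinnertonDyer.BirchSwinnertonDyer.Theorems.ClassRecordThreeEulerHalvesAtThreeJetchevHL
import Summits.BirchSwinnertonDyer.BirchSwinnertonDyer.Theorems.ClassRecordThreeEulerHalvesAtThreeSection6Bridge
import HarnessLib

/-!
# `stub_jetchevMaxHLAtThree` (item 19109 `EulerHalvesAtThree`, registered skeleton v4) REDUCED IN ITS OWN
# CURRENCY to two per-frame inputs — Kolyvagin's redefinition of `m_∞` (McCallum 1991 Lemma 5.1 +
# Prop. 5.2, print) and the per-level inequality of the kernel §6
# (`JET.Section6.tamagawaExponent_le_m_of_selmerFamilies`, p484791, to be instantiated) — everything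
# else kernel (cell `bsd-stepL`, seat `bsd-stepL-tam3-p1`, helper toward item 19109)

HONEST FRAMING. The stub is NOT discharged: `jetchevMaxHLAtThree_of_perLevel` has two
hypothesis-shaped binders per frame and nothing here supplies them; no item closes; 0 classes move
(T7); `--supports stmt-BirchSwinnertonDyer-19109` (helper). WHAT IT RECORDS, in the exact currency of
the registered stub (`KolyvaginHeegnerData Dt β ι n`, `Koly.PDiv d 3 s`, `Zhang2014.IsKolyvaginPrime`,
`Zhang2014.kolyvaginIndex`, the Hoffstein–Luo frame binders): after this session's kernel §6
(`…EulerHalvesAtThreeLozenge` p484140, `…CoreVertex` p484455, `…Section6Joined` p484791, `…Section6Bridge`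
p486458, on top of `bsd-jet`'s `Rank1ResidualJetSection6` p471669) the statement of
`stub_jetchevMaxHLAtThree` — VERBATIM, checked by elaborating `theorem stub… : ‹registered signature› :=
jetchevMaxHLAtThree_of_perLevel hK hlev` in the seat folder (`work/StubShapeCheck.lean`, rc 0) —
follows from, per frame `(W, K, Dt, β, ι)` of the stub:
* `hK` — Kolyvagin's redefinition of `m_∞` with its finiteness: a natural number `m_∞` with
  `m_∞ ≤ m(n)` for every admissible `(n, d)` (square-free product of Kolyvagin primes, any datum) and
  attained at admissible conductors of arbitrarily large `M(n)`; here `m(n) := ord₃(P_n)` if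
  `ord₃(P_n) < M(n)`, else `∞` (McCallum's convention `n ∈ S_r(ord_p P_n + 1)`, §5 p. 303, on the tree's
  `Koly.divOrd`, `Zhang2014.levelIndex`). PRINT: McCallum 1991 Lemma 5.1 (`M₀ = ord_p[E(K):ℤy_K] < ∞`
  for `y_K` of infinite order — true on the frame by Gross–Zagier, `r_an = 1`, `L(E^{d_K},1) ≠ 0`) +
  Prop. 5.2 («for `M > M_r` some `n ∈ S_r(M)` has `ord_p P_n = M_r`»), = the S9 input of the
  `bsd-jet` sheet `PV2-J6-KERNEL.md`; NOT typed here (a fact over `Koly.divOrd` is Summits-side).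
* `hlev` — for every finite place `v` of `ℚ`, level `k` and admissible `(n, d)` with `m(n) < k`,
  `ord₃ c_v ≤ k`, `k + m(n) ≤ M(n)`: `ord₃ c_v ≤ m(n)`. This is the conclusion of
  `JET.Section6.tamagawaExponent_le_m_of_selmerFamilies` with `t = ord₃ c_v(E)` and carrier `q` below
  `v`, once its level-`3^k` Selmer families are INSTANTIATED at `(n, d)` on `H¹(K, E[3^k])` (S1 signs,
  S2 the structures `𝓕`, `𝓕_⌈q⌉`, `𝓕^ℓ`, S3 (δ), S4 Lemma 6.1 at level `3^k`, S5 Prop. 4.7, S7 the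
  classes `κ, κ̃` of `d.derivedPoint`, S10 — NOT in the tree); for `3 ∤ c_v` it is trivial (`t = 0`).
So the reading-grade stub's kernel distance is now displayed in the tree as exactly {S9 print fact,
instantiation of the per-level families}; Jetchev §§5–6 incl. Prop. 6.4 contribute nothing further.
References (locators only; no cited FACT declared): [cite: Jetchev2008, Thm. 1.4 (p. 812), §3.1
(p. 817), Proof of Thm. 1.4 (p. 825)] [cite: McCallumLMS1991, §5 Lemma 5.1, Prop. 5.2 (pp. 303–304)]
[cite: WZhang2014, Notations (xii)]. Design: one theorem, no definitions (Jetchev's `m` is written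
inline). Axioms: `propext`, `Classical.choice`, `Quot.sound`.
-/

set_option autoImplicit false

noncomputable section

open scoped Classical NumberField

namespace Summit.BirchSwinnertonDyer.Rank1Residual.X11b.Three.Koly

open WeierstrassCurve Literature.NumberTheory.EllipticCurves
  Literature.NumberTheory.EllipticCurves.ModularForms
  Literature.NumberTheory.EllipticCurves.Rank1Residual
  Summit.BirchSwinnertonDyer.Rank1Residual Summit.BirchSwinnertonDyer.Rank1Residual.X11b
  IsDedekindDomain

/-- **`stub_jetchevMaxHLAtThree` ⟸ {Kolyvagin's redefinition of `m_∞` at the frame, the per-level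
inequality at the frame}, everything else kernel.** For every Hoffstein–Luo-type frame of the stub
(`r_an = 1`, `3 ∥ N` multiplicative, `Surj W 3`, `K` imaginary quadratic Heegner with `d_K` odd,
`L(E^{d_K},1) ≠ 0`, orientation `β`, Manin-good datum `Dt`), write `m(n) :=` McCallum's
`ord₃(P_n)` when `ord₃(P_n) < M(n)` and `∞` otherwise (`Koly.divOrd`, `Zhang2014.levelIndex`; the
convention of `n ∈ S_r(ord_p P_n + 1)`, McCallum §5 p. 303), on ADMISSIBLE conductors (square-free
products of Kolyvagin primes, `Zhang2014.IsKolyvaginPrime`). HYPOTHESES, per frame: `hK` = «`m_∞` is a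
natural number `≤ m(n)` for all admissible `(n, d)` and is attained at admissible conductors of
arbitrarily large `M(n)`» (McCallum 1991 Lemma 5.1 + Prop. 5.2 for `y_K` of infinite order — PRINT,
the S9 input; not typed here); `hlev` = for every finite place `v` of `ℚ`, level `k` and admissible
`(n, d)` with `m(n) < k`, `ord₃ c_v ≤ k`, `k + m(n) ≤ M(n)`: `ord₃ c_v ≤ m(n)` — the conclusion of
`JET.Section6.tamagawaExponent_le_m_of_selmerFamilies` (p484791) with `t = ord₃ c_v` once its
level-`3^k` Selmer families are instantiated at `(n, d)` (the carrier `q = char v`; for `3 ∤ c_v`,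
`t = 0` and `hlev` is trivial) — the instantiation layer, NOT in the tree. CONCLUSION: the statement of
`stub_jetchevMaxHLAtThree` VERBATIM (every derived Heegner point of the frame at an admissible
conductor with all Kolyvagin indices `≥ s ≤ ord₃ c_v` is `3^s`-divisible). PROOF: `pDiv_of_perLevel`
(`…Section6Bridge.lean`) at `p = 3`, `t = ord₃ c_v`. Nothing is discharged unconditionally; the stub
stays open; 0 classes move. [cite: Jetchev2008, Thm. 1.4 (p. 812), Proof of Thm. 1.4 (p. 825)]
[cite: McCallumLMS1991, §5 Lemma 5.1, Prop. 5.2 (pp. 303–304)] -/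
theorem jetchevMaxHLAtThree_of_perLevel
    (hK : ∀ (W : WeierstrassCurve ℚ) [W.IsElliptic] [W.IsGloballyMinimal] [NeZero (W.conductorNorm ℤ)]
      (K : Type) [Field K] [NumberField K]
      (Dt : ModularParametrizationData W (W.conductorNorm ℤ)) (β : ℤ) (ι : K →+* ℂ),
      W.analyticRank = 1 → W.HasMultiplicativeReductionAtPrime 3 → Surj W 3 →
      IsImaginaryQuadratic K → SatisfiesHeegnerHypothesis (W.conductorNorm ℤ) K →
      Odd (NumberField.discr K) → (W.quadraticTwist (NumberField.discr K : ℚ)).entireLFunction 1 ≠ 0 →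
      (4 * (W.conductorNorm ℤ : ℤ)) ∣ β ^ 2 - NumberField.discr K → ¬ (3 : ℤ) ∣ Dt.c →
      ∃ mInf : ℕ,
        (∀ (n : ℕ) (d : KolyvaginHeegnerData Dt β ι n), Squarefree n →
          (∀ ℓ ∈ n.primeFactors, Zhang2014.IsKolyvaginPrime (W.conductorNorm ℤ) W K 3 ℓ) →
          (mInf : ℕ∞) ≤
            (if divOrd d 3 < Zhang2014.levelIndex W 3 n then divOrd d 3 else ⊤)) ∧
        (∀ m' : ℕ, ∃ (n : ℕ) (d : KolyvaginHeegnerData Dt β ι n), Squarefree n ∧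
          (∀ ℓ ∈ n.primeFactors, Zhang2014.IsKolyvaginPrime (W.conductorNorm ℤ) W K 3 ℓ) ∧
          (m' : ℕ∞) ≤ Zhang2014.levelIndex W 3 n ∧
          (if divOrd d 3 < Zhang2014.levelIndex W 3 n then divOrd d 3 else (⊤ : ℕ∞)) = mInf))
    (hlev : ∀ (W : WeierstrassCurve ℚ) [W.IsElliptic] [W.IsGloballyMinimal] [NeZero (W.conductorNorm ℤ)]
      (K : Type) [Field K] [NumberField K]
      (Dt : ModularParametrizationData W (W.conductorNorm ℤ)) (β : ℤ) (ι : K →+* ℂ),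
      W.analyticRank = 1 → W.HasMultiplicativeReductionAtPrime 3 → Surj W 3 →
      IsImaginaryQuadratic K → SatisfiesHeegnerHypothesis (W.conductorNorm ℤ) K →
      Odd (NumberField.discr K) → (W.quadraticTwist (NumberField.discr K : ℚ)).entireLFunction 1 ≠ 0 →
      (4 * (W.conductorNorm ℤ : ℤ)) ∣ β ^ 2 - NumberField.discr K → ¬ (3 : ℤ) ∣ Dt.c →
      ∀ (v : HeightOneSpectrum (𝓞 ℚ)) (k n : ℕ) (d : KolyvaginHeegnerData Dt β ι n), Squarefree n →
        (∀ ℓ ∈ n.primeFactors, Zhang2014.IsKolyvaginPrime (W.conductorNorm ℤ) W K 3 ℓ) →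
        (if divOrd d 3 < Zhang2014.levelIndex W 3 n then divOrd d 3 else (⊤ : ℕ∞)) < (k : ℕ∞) →
        padicValNat 3 (W.tamagawaNumberAt v) ≤ k →
        (k : ℕ∞) + (if divOrd d 3 < Zhang2014.levelIndex W 3 n then divOrd d 3 else ⊤) ≤
          Zhang2014.levelIndex W 3 n →
        (padicValNat 3 (W.tamagawaNumberAt v) : ℕ∞) ≤
          (if divOrd d 3 < Zhang2014.levelIndex W 3 n then divOrd d 3 else ⊤)) :
    ∀ (W : WeierstrassCurve ℚ) [W.IsElliptic] [W.IsGloballyMinimal] [NeZero (W.conductorNorm ℤ)]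
      (K : Type) [Field K] [NumberField K]
      (Dt : ModularParametrizationData W (W.conductorNorm ℤ)) (β : ℤ) (ι : K →+* ℂ),
      W.analyticRank = 1 → W.HasMultiplicativeReductionAtPrime 3 → Surj W 3 →
      IsImaginaryQuadratic K → SatisfiesHeegnerHypothesis (W.conductorNorm ℤ) K →
      Odd (NumberField.discr K) → (W.quadraticTwist (NumberField.discr K : ℚ)).entireLFunction 1 ≠ 0 →
      (4 * (W.conductorNorm ℤ : ℤ)) ∣ β ^ 2 - NumberField.discr K → ¬ (3 : ℤ) ∣ Dt.c →
      ∀ (v : HeightOneSpectrum (𝓞 ℚ)) (s : ℕ), s ≤ padicValNat 3 (W.tamagawaNumberAt v) →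
        ∀ (n : ℕ) (d : KolyvaginHeegnerData Dt β ι n), Squarefree n →
          (∀ ℓ ∈ n.primeFactors, Zhang2014.IsKolyvaginPrime (W.conductorNorm ℤ) W K 3 ℓ ∧
            s ≤ Zhang2014.kolyvaginIndex W 3 ℓ) → PDiv d 3 s := by
  intro W _ _ _ K _ _ Dt β ι hr hmult hρ hK' hHN hodd hLt hβ hc v s hs n d hn hℓ
  obtain ⟨mInf, hmInf, hKol⟩ := hK W K Dt β ι hr hmult hρ hK' hHN hodd hLt hβ hc
  exact pDiv_of_perLevel (Dt := Dt) (β := β) (ι := ι) 3 (padicValNat 3 (W.tamagawaNumberAt v)) mInf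
    (fun n d => if divOrd d 3 < Zhang2014.levelIndex W 3 n then divOrd d 3 else ⊤)
    (fun n d _ _ h => by simp [h]) hmInf hKol
    (fun k n d hn' hℓ' h1 h2 h3 =>
      hlev W K Dt β ι hr hmult hρ hK' hHN hodd hLt hβ hc v k n d hn' hℓ' h1 h2 h3)
    s hs n d hn hℓ

end Summit.BirchSwinnertonDyer.Rank1Residual.X11b.Three.Koly

end
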